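import Summits.BirchSwinnertonDyer.BirchSwinnertonDyer.Theorems.ResidualThetaTransportAtTwoPlusDualLayerNorms
import Summits.BirchSwinnertonDyer.BirchSwinnertonDyer.Theorems.ResidualThetaTransportAtTwoPlusDualEigenCount
import Summits.BirchSwinnertonDyer.BirchSwinnertonDyer.Theorems.ResidualThetaTransportAtTwoPlusDualIsoLambdaTwo
import HarnessLib

/-!
# Route `ResidualThetaTransportAtTwo` (RTT P6, item stmt-BirchSwinnertonDyer-23110, road T), H-PLUSDUAL / ISO brick (C), point level:
# every twisted eigen-class of `(⋃ₙ E⁺(ℚ_{2,n}))/2^J` is the TWISTED NORM of a layer-`J` class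

Width seat `bsd-wall-tp2-p2x-w2` g16 (cell `bsd-wall`), for the LEAD `bsd-wall-tp2-p2x` g12 (skeleton `hplusdual`, stub `stub_iso`).
HONEST FRAMING: THEOREMS ONLY (no definition, no named fact, no instance, no `sorry`); closes no item; BSD is NOT proved by any of this.

B. D. Kim (Compositio 143 (2007), proof of Prop. 4.11, p. 63): «Thus we can show `Cor_𝔭(H^n_{𝔭,P}[𝔪^k_P]) = H^0_{𝔭,P}[𝔪^k_P]`». On
points: with `A = ⋃ₙ E⁺(ℚ_{v,n})`, `g` a local lift of the topological generator, `u u' ≡ 1 (mod 2^J)`, every `a ∈ A` with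
`g a ≡ u' a (mod 2^J A)` (the point of a class of `L_u`, `…RlfTwistedLocalKummerWitness.exists_eigen_of_witness`) is congruent
modulo `2^J A` to the twisted norm `Σ_{i<2^J} uⁱ gⁱ b` of some `b ∈ A` with `g^{2^J} b ≡ b (mod 2^J A)` (the point of a layer-`J`
class). The algebra is w3 g13's `ResidualThetaLayer.PlusDual.twistedNorm_image_torsionBy_eq` (cofree dual pair: twisted norms of
`S[2^J, φ^{2^J} = 1]` exhaust `S[2^J, u φ = 1]`), read through the divisible hull `S` of `A` (`exists_divisibleHull`) and (R1)@2
(`nonempty_linearEquiv_of_hull` with the point-level inputs `PlusModP.plusFixedModTwo_dep_iSup_two`, `PlusRankGrowth.not_exists_finset_cover_mod_two`).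

* `ResidualThetaLayer.PlusDual.exists_twistedNorm_congr_of_hull` — ABSTRACT (any `p`, any realization of the hull of `(A, γ)` with
  the two point-level inputs, `γ` additive): the statement above with `c, c'`, `p^J ∣ c c' − 1`, `p^J ∣ c^{p^m} − 1`, layer `m`.
* **`SignedEC.PlusDualTwo.exists_twistedNorm_congr_two`** — `K = ℚ`, `p = 2`, `A = ⋃ₙ E⁺(ℚ_{2,n})`, layer `m = J`: UNCONDITIONAL for
  `GoodSS W 2`, `a₂(W) = 0`, `κ` cyclotomic.

References: B. D. Kim, Compositio Math. 143 (2007), Prop. 3.15 (proof, «`Cor^m_n(H_m[p^j]) = H_n[p^j]`»), Prop. 4.11 [BDKim2007];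
R. Greenberg, LNM 1716 §1 p. 60 [GreenbergLNM1716]; S. Kobayashi, Invent. math. 152 (2003), Thm. 6.2, Prop. 8.12 [Kobayashi2003].
-/

set_option autoImplicit false
-- D-0017: single-problem summit, so `Summit.BirchSwinnertonDyer.BirchSwinnertonDyer.…` repeats a namespace BY DESIGN.
set_option linter.dupNamespace false

noncomputable section

open scoped Classical NumberField
open Literature.NumberTheory.EllipticCurves Literature.NumberTheory.EllipticCurves.IwasawaDual

namespace Summit.BirchSwinnertonDyer.BirchSwinnertonDyer.Theorems.ResidualThetaLayer.PlusDual

/-! ## §1 The abstract statement for a realization of the hull of `(A, γ)` -/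

section Hull

variable {p : ℕ} [Fact p.Prime]
variable {L : Type*} [AddCommGroup L] {A : AddSubgroup L} (γ : AddMonoid.End L)
variable {S : Type*} [AddCommGroup S] {φ : AddMonoid.End S}

/-- **Twisted eigen-classes are twisted norms of layer classes (point level, abstract).** For a realization `(S, φ, ι_k)` of the
hull of `(A, γ)` (`γ` additive, `A` `γ`-stable) with `p`-power `γ`-periods and the two point-level inputs of (R1) (pairwise
dependence of the `γ`-fixed classes of `A/pA`; no finite cover of `A` mod `p`), integers `c, c' ≡ 1 (mod p)` with `p^J ∣ c c' − 1` and a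
layer `m` with `p^J ∣ c^{p^m} − 1`: every `a ∈ A` with `γ a − c' a ∈ p^J A` satisfies `Σ_{i<p^m} cⁱ γⁱ b − a ∈ p^J A` for some `b ∈ A`
with `γ^{p^m} b − b ∈ p^J A`. (`ι_J a ∈ S[p^J, c φ = 1] = N(S[p^J, φ^{p^m} = 1])`, `N = Σ (cφ)ⁱ` — `twistedNorm_image_torsionBy_eq`.)
[cite: BDKim2007, Prop. 4.11 (proof, p. 63)] [cite: BDKim2007, Prop. 3.15 (proof)] -/
theorem exists_twistedNorm_congr_of_hull (hγA : ∀ x ∈ A, γ x ∈ A)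
    (ι : ℕ → (A →+ S)) (h0 : ∀ x : A, ι 0 x = 0) (hsucc : ∀ (k : ℕ) (x : A), p • ι (k + 1) x = ι k x)
    (hsurj : ∀ s : S, ∃ (k : ℕ) (x : A), ι k x = s)
    (hker : ∀ (k : ℕ) (x : A), ι k x = 0 → ∃ w : A, (x : L) = p ^ k • (w : L))
    (hequiv : ∀ (k : ℕ) (x : A), φ (ι k x) = ι k ⟨γ x, hγA x x.2⟩)
    (hper : ∀ x : A, ∃ n : ℕ, γ^[p ^ n] (x : L) = x)
    (hdep : ∀ x ∈ A, ∀ y ∈ A, (∃ w ∈ A, γ x - x = p • w) → (∃ w ∈ A, γ y - y = p • w) →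
      ∃ a b : ℤ, ¬ ((p : ℤ) ∣ a ∧ (p : ℤ) ∣ b) ∧ ∃ w ∈ A, a • x + b • y = p • w)
    (hinf : ¬ ∃ F : Finset L, ∀ x ∈ A, ∃ r ∈ F, ∃ w ∈ A, x = r + p • w)
    {c c' : ℤ} (hc : (p : ℤ) ∣ c - 1) (J m : ℕ) (hcc' : ((p : ℤ) ^ J) ∣ c * c' - 1)
    (hcJ : ((p : ℤ) ^ J) ∣ c ^ p ^ m - 1)
    (a : L) (ha : a ∈ A) (heig : ∃ w ∈ A, γ a - c' • a = p ^ J • w) :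
    ∃ b ∈ A, (∃ w ∈ A, (γ ^ p ^ m) b - b = p ^ J • w) ∧
      ∃ w ∈ A, (∑ i ∈ Finset.range (p ^ m), c ^ i • (γ ^ i) b) - a = p ^ J • w := by
  have hp : p.Prime := Fact.out
  -- bookkeeping along the tower `ι`
  have htor : ∀ (k : ℕ) (x : A), p ^ k • ι k x = 0 := by
    intro k
    induction k with
    | zero => intro x; rw [h0, smul_zero]
    | succ k ih => intro x; rw [pow_succ, mul_smul, hsucc, ih]
  have hdown : ∀ (n k : ℕ) (x : A), p ^ n • ι (k + n) x = ι k x := by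
    intro n
    induction n with
    | zero => intro k x; rw [pow_zero, one_smul, add_zero]
    | succ n ih => intro k x; rw [pow_succ, mul_smul, ← add_assoc, hsucc, ih]
  have hshift : ∀ (n k : ℕ) (x : A), ι (k + n) (p ^ n • x) = ι k x := fun n k x ↦ by rw [map_nsmul, hdown]
  have hSJ : ∀ s : S, p ^ J • s = 0 → ∃ x : A, ι J x = s := by
    intro s hs
    obtain ⟨k, x, rfl⟩ := hsurj s
    rcases le_or_gt k J with hkJ | hJk
    · obtain ⟨n, rfl⟩ := Nat.exists_eq_add_of_le hkJ
      exact ⟨p ^ n • x, hshift n k x⟩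
    · obtain ⟨n, rfl⟩ := Nat.exists_eq_add_of_lt hJk
      have h1 : ι (n + 1) x = 0 := by rw [← hdown J (n + 1) x, show n + 1 + J = J + n + 1 by ring]; exact hs
      obtain ⟨w, hw⟩ := hker (n + 1) x h1
      have hx : x = p ^ (n + 1) • w := Subtype.ext (by rw [hw, AddSubgroup.coe_nsmul])
      refine ⟨w, ?_⟩
      rw [hx, show J + n + 1 = J + (n + 1) by ring, hshift]
  have hkerJ : ∀ x : A, ι J x = 0 → ∃ w ∈ A, (x : L) = p ^ J • w := fun x hx ↦ by
    obtain ⟨w, hw⟩ := hker J x hx; exact ⟨w, w.2, hw⟩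
  have hιpJ : ∀ (x : L) (hx : p ^ J • x ∈ A) (hx' : x ∈ A), ι J ⟨p ^ J • x, hx⟩ = 0 := fun x hx hx' ↦ by
    rw [show (⟨p ^ J • x, hx⟩ : A) = p ^ J • ⟨x, hx'⟩ from Subtype.ext (by rw [AddSubgroup.coe_nsmul]), map_nsmul, htor]
  -- iterates: `(φ^i) (ι k x) = ι k (γ^i x)`
  have hγpow : ∀ (i : ℕ) (x : L), x ∈ A → (γ ^ i) x ∈ A := by
    intro i
    induction i with
    | zero => intro x hx; simpa using hx
    | succ i ih => intro x hx; rw [pow_succ', AddMonoid.End.coe_mul, Function.comp_apply]; exact hγA _ (ih x hx)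
  have hiter : ∀ (i k : ℕ) (x : A), (φ ^ i) (ι k x) = ι k ⟨(γ ^ i) x, hγpow i x x.2⟩ := by
    intro i
    induction i with
    | zero => intro k x; rfl
    | succ i ih =>
      intro k x
      rw [pow_succ' φ i, AddMonoid.End.coe_mul, Function.comp_apply, ih, hequiv]
      congr 1
      exact Subtype.ext (show γ ((γ ^ i) (x : L)) = (γ ^ (i + 1)) (x : L) by
        rw [pow_succ', AddMonoid.End.coe_mul, Function.comp_apply])
  have hiter' : ∀ (n : ℕ) (x : L), (⇑γ)^[n] x = (γ ^ n) x := fun n x ↦ by rw [AddMonoid.End.coe_pow]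
  -- the canonical dual pair `(Hom(S, ℚ/ℤ), id)` is free of rank one
  have hloc : IsLocNil p (φ - 1) := by
    refine ⟨fun s ↦ ?_, fun s ↦ ?_⟩
    · obtain ⟨k, x, rfl⟩ := hsurj s
      exact ⟨k, htor k x⟩
    · obtain ⟨k, x, rfl⟩ := hsurj s
      obtain ⟨n, hn⟩ := hper x
      have hfix : (φ ^ p ^ n) (ι k x) = ι k x := by
        rw [hiter]; congr 1; exact Subtype.ext (show (γ ^ p ^ n) (x : L) = x by rw [← hiter']; exact hn)
      exact ⟨k * p ^ n, IwasawaDual.pow_mul_prime_pow_apply_eq_zero hp φ n hfix (htor k x)⟩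
  letI : Module (PowerSeries ℤ_[p]) (S →+ AddCircle (1 : ℚ)) := hloc.module
  have hpair : IsDualPair p (φ - 1) (AddMonoidHom.id (S →+ AddCircle (1 : ℚ))) :=
    { bijective := Function.bijective_id
      T_smul := fun x s ↦ hloc.smulFun_X_apply x s
      C_smul := fun c'' x s k hk ↦ hloc.smulFun_C_apply c'' x hk
      locNil := hloc }
  obtain ⟨e⟩ := nonempty_linearEquiv_of_hull (γ := ⇑γ) hpair hγA ι h0 hsucc hsurj hker hequiv hdep hinf
  -- `ι_J a` is a twisted eigenvector
  have himg := twistedNorm_image_torsionBy_eq hpair e hc m J hcJ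
  have haS : ι J ⟨a, ha⟩ ∈ {s : S | p ^ J • s = 0 ∧ c • φ s = s} := by
    refine ⟨htor J _, ?_⟩
    obtain ⟨w, hwA, hw⟩ := heig
    obtain ⟨d, hd⟩ := hcc'
    rw [hequiv, ← map_zsmul, ← sub_eq_zero, ← map_sub]
    have e1 : (c • (⟨γ a, hγA a ha⟩ : A) - ⟨a, ha⟩ : A) = p ^ J • (c • (⟨w, hwA⟩ : A) + d • ⟨a, ha⟩) := Subtype.ext (by
      simp only [AddSubgroup.coe_sub, AddSubgroup.coe_zsmul, AddSubgroup.coe_nsmul, AddSubgroup.coe_add]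
      have hγa : γ a = c' • a + p ^ J • w := by rw [← hw]; abel
      rw [hγa, ← natCast_zsmul w (p ^ J), ← natCast_zsmul (c • w + d • a) (p ^ J), Nat.cast_pow, smul_add c, smul_smul,
        show c * c' = 1 + (p : ℤ) ^ J * d by rw [← hd]; ring, add_smul, one_smul, mul_smul, smul_comm c ((p : ℤ) ^ J) w,
        smul_add ((p : ℤ) ^ J)]
      abel)
    rw [e1, map_nsmul, htor]
  rw [← himg] at haS
  obtain ⟨t, ⟨htJ, htfix⟩, hNt⟩ := haS
  obtain ⟨b, rfl⟩ := hSJ t htJ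
  refine ⟨(b : L), b.2, ?_, ?_⟩
  · -- `γ^{p^m} b − b ∈ p^J A`
    have h1 : ι J (⟨(γ ^ p ^ m) b, hγpow _ _ b.2⟩ - b) = 0 := by rw [map_sub, ← hiter, htfix, sub_self]
    obtain ⟨w, hwA, hw⟩ := hkerJ _ h1
    exact ⟨w, hwA, by rw [← hw, AddSubgroup.coe_sub]⟩
  · -- the twisted norm
    have hN : (∑ i ∈ Finset.range (p ^ m), ((c : AddMonoid.End S) * φ) ^ i : AddMonoid.End S) (ι J b) =
        ι J ⟨∑ i ∈ Finset.range (p ^ m), c ^ i • (γ ^ i) b, A.sum_mem fun i _ ↦ A.zsmul_mem (hγpow i _ b.2) _⟩ := by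
      rw [end_finset_sum_apply]
      have hci : ∀ i : ℕ, (((c : AddMonoid.End S) * φ) ^ i) (ι J b) = ι J ⟨c ^ i • (γ ^ i) b, A.zsmul_mem (hγpow i _ b.2) _⟩ := by
        intro i
        have hcomm : Commute (c : AddMonoid.End S) φ := (Int.cast_commute c φ)
        rw [hcomm.mul_pow, AddMonoid.End.coe_mul, Function.comp_apply, hiter, ← Int.cast_pow, AddMonoid.End.intCast_apply,
          ← map_zsmul]
        rfl
      rw [Finset.sum_congr rfl fun i _ ↦ hci i, ← map_sum]
      congr 1
      exact Subtype.ext (by rw [AddSubgroup.val_finsetSum])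
    rw [hN, ← sub_eq_zero, ← map_sub] at hNt
    obtain ⟨w, hwA, hw⟩ := hkerJ _ hNt
    exact ⟨w, hwA, by rw [← hw, AddSubgroup.coe_sub]⟩

end Hull

end Summit.BirchSwinnertonDyer.BirchSwinnertonDyer.Theorems.ResidualThetaLayer.PlusDual

/-! ## §2 `K = ℚ`, `p = 2`, `A = ⋃ₙ E⁺(ℚ_{2,n})`, layer `J` — unconditionally -/

namespace Summit.BirchSwinnertonDyer.BirchSwinnertonDyer.Theorems.SignedEC.PlusDualTwo

open Literature.NumberTheory.GaloisRepresentations WeierstrassCurve ZpExtension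
  Literature.NumberTheory.EllipticCurves.Kobayashi2003 Literature.NumberTheory.EllipticCurves.Sprung2012
  Summit.BirchSwinnertonDyer.Rank1Residual.Additive NumberField IsDedekindDomain

variable (W : WeierstrassCurve ℚ) [W.IsElliptic] [W.IsGloballyMinimal]

/-- **Every twisted eigen-class of `(⋃ₙ E⁺(ℚ_{2,n}))/2^J` is the twisted norm of a layer-`J` class — UNCONDITIONALLY.** For `W/ℚ`
globally minimal with good supersingular reduction at `2` and `a₂(W) = 0`, `κ` cyclotomic, `v ∋ 2`, `g ∈ Γ_{ℚ_v}` a local lift of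
the topological generator, `A = ⋃ₙ E⁺(ℚ_{2,n})`, `u u' ≡ 1 (mod 2^J)`: every `a ∈ A` with `g a − u' a ∈ 2^J A` is congruent modulo
`2^J A` to `Σ_{i<2^J} uⁱ gⁱ b` for some `b ∈ A` with `g^{2^J} b − b ∈ 2^J A`. Inputs: `exists_divisibleHull`, (R1)@2 via
`exists_twistedNorm_congr_of_hull` (`PlusModP.plusFixedModTwo_dep_iSup_two`, `PlusRankGrowth.not_exists_finset_cover_mod_two`),
w3's `twistedNorm_image_torsionBy_eq`. [cite: BDKim2007, Prop. 4.11 (proof, p. 63)] [cite: BDKim2007, Prop. 3.17] -/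
theorem exists_twistedNorm_congr_two (hss : Rank1Residual.GoodSS W 2) (ha : W.frobeniusTrace 2 = 0)
    {κ : ZpExtension ℚ 2} (hκ : κ.IsCyclotomic) (v : HeightOneSpectrum (𝓞 ℚ)) (hv : (2 : 𝓞 ℚ) ∈ v.asIdeal)
    {g : Field.absoluteGaloisGroup (v.adicCompletion ℚ)}
    (hg : κ.IsTopGenerator (resGalOfEmb (closureEmb (K := ℚ) (v.adicCompletion ℚ)) g)) (J : ℕ) {u u' : ℤ}
    (hu : (2 : ℤ) ∣ u - 1) (huu' : ((2 : ℤ) ^ J) ∣ u * u' - 1)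
    {a : localPoints W (v.adicCompletion ℚ)} (haA : a ∈ ⨆ n, signedLocalPoints κ (v.adicCompletion ℚ) W 1 n)
    (heig : ∃ w ∈ (⨆ n, signedLocalPoints κ (v.adicCompletion ℚ) W 1 n), g • a - u' • a = 2 ^ J • w) :
    ∃ b ∈ (⨆ n, signedLocalPoints κ (v.adicCompletion ℚ) W 1 n),
      (∃ w ∈ (⨆ n, signedLocalPoints κ (v.adicCompletion ℚ) W 1 n), g ^ (2 ^ J) • b - b = 2 ^ J • w) ∧
      ∃ w ∈ (⨆ n, signedLocalPoints κ (v.adicCompletion ℚ) W 1 n),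
        (∑ i ∈ Finset.range (2 ^ J), u ^ i • (g ^ i • b)) - a = 2 ^ J • w := by
  haveI : Fact (Nat.Prime 2) := ⟨Nat.prime_two⟩
  set ι₀ := closureEmb (K := ℚ) (v.adicCompletion ℚ) with hι₀
  set A : AddSubgroup (localPoints W (v.adicCompletion ℚ)) := ⨆ n, signedLocalPoints κ (v.adicCompletion ℚ) W 1 n with hAdef
  have hγA : ∀ x ∈ A, g • x ∈ A := fun x hx ↦ smul_mem_iSup_signedLocalPoints W κ v g hx
  have hAtower : A ≤ Sprung2012.localTowerPointsOfEmb κ ι₀ W := iSup_signedLocalPoints_le_localTowerPointsOfEmb W κ v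
  have hA2 : ∀ x : A, 2 • x = 0 → x = 0 := fun x h2 ↦ Subtype.ext
    (SSFlatEC.eq_zero_of_mem_localTowerPointsOfEmb_of_two_nsmul W hss κ (by exact_mod_cast hv) ι₀ (hAtower x.2)
      (by rw [← AddSubgroup.coe_nsmul, h2, AddSubgroup.coe_zero]))
  -- the `g`-action as an additive endomorphism of the local points and of `A`
  let γ : AddMonoid.End (localPoints W (v.adicCompletion ℚ)) := DistribSMul.toAddMonoidHom (localPoints W (v.adicCompletion ℚ)) g
  have hγ : ∀ x, γ x = g • x := fun _ ↦ rfl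
  have hγpow : ∀ (i : ℕ) (x : localPoints W (v.adicCompletion ℚ)), (γ ^ i) x = g ^ i • x := by
    intro i x
    rw [← (show ((fun y : localPoints W (v.adicCompletion ℚ) ↦ g • y)^[i]) x = (γ ^ i) x by
      rw [AddMonoid.End.coe_pow, show (fun y : localPoints W (v.adicCompletion ℚ) ↦ g • y) = ⇑γ from (funext hγ).symm]),
      smul_iterate]
  have hγA' : ∀ x ∈ A, γ x ∈ A := fun x hx ↦ hγA x hx
  let γA : A →+ A := ((γ : localPoints W (v.adicCompletion ℚ) →+ _).comp A.subtype).codRestrict A fun x ↦ hγA x x.2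
  obtain ⟨S, _, φ, ι, h0, hsucc, hsurj, hker, hequiv⟩ := ResidualThetaLayer.PlusDual.exists_divisibleHull (p := 2) A hA2 γA
  have hker' : ∀ (k : ℕ) (x : A), ι k x = 0 → ∃ w : A, (x : localPoints W (v.adicCompletion ℚ)) = 2 ^ k • (w : localPoints W _) :=
    fun k x hx ↦ by obtain ⟨w, hw⟩ := hker k x hx; exact ⟨w, by rw [hw, AddSubgroup.coe_nsmul]⟩
  have hequiv' : ∀ (k : ℕ) (x : A), (φ : AddMonoid.End S) (ι k x) = ι k ⟨γ (x : localPoints W _), hγA' x x.2⟩ := by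
    intro k x
    rw [show (φ : AddMonoid.End S) (ι k x) = φ (ι k x) from rfl, hequiv]
    rfl
  -- `2`-power periods
  have hper : ∀ x : A, ∃ n : ℕ, (⇑γ)^[2 ^ n] (x : localPoints W _) = x := by
    intro x
    obtain ⟨m, hxm⟩ := (AddSubgroup.mem_iSup_of_directed (signedLocalPointsOfEmb_mono κ ι₀ W 1).directed_le).1 x.2
    refine ⟨m, ?_⟩
    rw [show (⇑γ) = fun y : localPoints W (v.adicCompletion ℚ) ↦ g • y from funext hγ, smul_iterate]
    simpa using Sprung2012.pow_mul_smul_of_mem_localLayerPointsOfEmb κ ι₀ W hg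
      (((mem_signedLocalPointsOfEmb_iff κ ι₀ W 1 m _).1 hxm).1) 1
  -- `2^J ∣ u^{2^J} − 1`
  have hcJ : ((2 : ℤ) ^ J) ∣ u ^ 2 ^ J - 1 := by
    have h := dvd_sub_pow_of_dvd_sub (R := ℤ) (p := 2) (a := u) (b := 1) hu J
    rw [one_pow] at h
    exact (pow_dvd_pow (2 : ℤ) (Nat.le_succ J)).trans h
  obtain ⟨b, hbA, ⟨w₁, hw₁A, hw₁⟩, w₂, hw₂A, hw₂⟩ :=
    ResidualThetaLayer.PlusDual.exists_twistedNorm_congr_of_hull (p := 2) γ hγA' ι h0 hsucc hsurj hker' hequiv' hper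
      (PlusModP.plusFixedModTwo_dep_iSup_two W hss ha hκ v hv hg) (by
        rintro ⟨F, hF⟩
        refine PlusRankGrowth.not_exists_finset_cover_mod_two W hss ha κ hκ v hv ⟨F, fun x hx ↦ ?_⟩
        obtain ⟨r, hr, w, hw, hxe⟩ := hF x hx
        exact ⟨r, hr, w, hAtower hw, hxe⟩) hu J J huu' hcJ a haA heig
  refine ⟨b, hbA, ⟨w₁, hw₁A, by rw [← hw₁, hγpow]⟩, w₂, hw₂A, ?_⟩
  rw [← hw₂]
  congr 1
  exact Finset.sum_congr rfl fun i _ ↦ by rw [hγpow]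

end Summit.BirchSwinnertonDyer.BirchSwinnertonDyer.Theorems.SignedEC.PlusDualTwo

end
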